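import Mathlib
import Literature.NumberTheory.LFunctions.Zhang2022.RepairBedUaSignModel
import HarnessLib

/-!
# Zhang (2022), rescue bed (D-0124 (3)) node D130-4 «U-a sign», MODEL side III: the kernel-mode restoration levels
# `m_K*(v,θ) = uKThreshold (M_θ(g⋆,v)) (Re 𝔅_θ(v))` at the eight registered cells as kernel windows, and the atom
# windows at the three closing cells `(v_J,2)`, `(v_J,3)`, `(φ,3)` used by the companion `RepairBedUaSignSlots`

Topic `Literature/NumberTheory/LFunctions/Zhang2022` (Landau–Siegel audit tree; verdict-neutral).
Y. Zhang, *Discrete mean estimates and the Landau–Siegel zero*, arXiv:2211.02515v1 (2022) [Zhang2022LandauSiegel] —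
**an unrefereed manuscript under adjudication; nothing here asserts or denies any of its claims, and nothing here is
a claim about Landau–Siegel zeros.**

Companion of `RepairBedUaSignModel` (atoms `𝔅(u_T) = 8/π + 52π/3`, `c₀ = tailCoupling`, `|c₀|² = 36π²(1+π²)h⁴` /
`4π²(1+π²)h⁶`, the X = 0 closing criterion, the sign table, `θ*`, the kernel-mode rows `gStar_jump_closes` /
`gStar_phiT_closes`) and `RepairBedUaSignCurrencies` (sizes, `C*`/`C_req` windows); `RepairBedLenxModel` /
`RepairBedLenxClosedForms` supply `uKThreshold c b = ‖c‖²/b` («PSD restored by the uu slot ALONE ⇔ m_K ≥ m_K*»,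
`blockQuad_nonneg_iff_threshold`), `M_θ(g⋆, v_J) = 12πh²` (`MformTop_gStar_jumpProfile`), `M_θ(g⋆, φ_θ) = 4πh³`
(`MformTop_gStar_phiT_eq`), `Re 𝔅_θ(v_J) = 8h/π + 52πh³/3`, `Re 𝔅_θ(φ_θ) = 8h³/(3π) + 44πh⁵/15` (`h = θ − 1`). The bed-7
word SP7 («m_K/m_K* ∈ [3,15] at θ = 2, [2,8] at θ = 3; D = −163 exception at S1») divides the genuine `κ_K`-scaled uu
entry by the MODEL level `m_K*(v,θ)`, which at the registered `θ` was numeric-only (lineage C + ls-rescue-ref-1's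
re-derivation). This file records, as theorems of the continued calculus (no definition, no `Prop` placeholder):

* Part 0 — atom windows at the closing cells (twenty-digit `π`): `𝔅(u_T) ∈ (57.00075175, 57.00075176)`
  (`mainTermForm_taperProfile_window20`), `Re 𝔅_3(v_J) = 16/π + 416π/3 ∈ (440.7271394, 440.7271395)`,
  `Re 𝔅_3(φ_3) = 64/(3π) + 1408π/15 ∈ (301.6814413, 301.6814414)`, the three `|c₀|²` windows
  (`normSq_tailCoupling_*_window`: `36·`, `576·`, `256·π²(1+π²)`), the cell atoms
  `cellAtoms_jump_two/_jump_three/_phiT_three` (`k₀`, `|c₀|²` in closed form) and the identity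
  **`Re 𝔅_2(v_J) = 𝔅(u_T)`** (`topDiagForm_jump_two_re_eq_mainTermForm`: the bed's shape number `b_m(v_J,2) = 1`);
* Part 1 — the levels in `π`-cleared closed form, `m_K*(v_J,θ) = 432π³h³/(24 + 52π²h²)` (`uKThreshold_gStar_jump_eq`),
  `m_K*(φ,θ) = 240π³h³/(40 + 44π²h²)` (`uKThreshold_gStar_phiT_eq`), and **the eight registered levels as windows**:
  `v_J`: `θ = 5/4 ∈ (3.73, 3.74)`, `3/2 ∈ (10.99, 11.00)`, `2 ∈ (24.93, 24.94)`, `3 ∈ (51.59, 51.60)`;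
  `φ_θ`: `5/4 ∈ (1.73, 1.74)`, `3/2 ∈ (6.26, 6.27)`, `2 ∈ (15.69, 15.70)`, `3 ∈ (33.50, 33.51)` (`uKThreshold_window_*`;
  bed-7 printed `3.73/10.99/24.93/51.60`, `1.73/6.26/15.69/33.50`).

Caveat as in the kit: `M_θ`, `θ > 1`, is formula I's calculus CONTINUED past `P`, not a proved main term. Nothing here
evaluates a genuine block, touches a registered word, or asserts an off-diagonal input. Theorems only; no `instance`,
no notation. Numeric pre-validation (40 digits): bed-7 g3 session `work/p7num.py`.

## References

* Y. Zhang, arXiv:2211.02515v1 (2022), §7 Prop 7.1, (7.2) p.44; §8 (8.11)–(8.12). [cite: Zhang2022LandauSiegel, §§7, 8]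
-/

noncomputable section

open Complex Real ComplexConjugate Set intervalIntegral
open _root_.MeasureTheory

namespace Literature.NumberTheory.LFunctions.Zhang2022.Repair.Bed

open KnifeEdge

/-! ### Part 0 — twenty-digit `π` and the atom windows at the closing cells -/

section Atoms

/-- Twenty-digit `π`: windows for `π`, `π²`, `π³`, `π⁴`. [folklore] -/
private theorem pi_bounds20 :
    3.14159265358979323846 < π ∧ π < 3.14159265358979323847
      ∧ 3.14159265358979323846 ^ 2 < π ^ 2 ∧ π ^ 2 < 3.14159265358979323847 ^ 2
      ∧ 3.14159265358979323846 ^ 3 < π ^ 3 ∧ π ^ 3 < 3.14159265358979323847 ^ 3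
      ∧ 3.14159265358979323846 ^ 4 < π ^ 4 ∧ π ^ 4 < 3.14159265358979323847 ^ 4 := by
  have h1 := Real.pi_gt_d20
  have h2 := Real.pi_lt_d20
  have h0 : (0:ℝ) ≤ 3.14159265358979323846 := by norm_num
  have hπ : 0 ≤ π := Real.pi_pos.le
  exact ⟨h1, h2, pow_lt_pow_left₀ h1 h0 (by norm_num), pow_lt_pow_left₀ h2 hπ (by norm_num),
    pow_lt_pow_left₀ h1 h0 (by norm_num), pow_lt_pow_left₀ h2 hπ (by norm_num),
    pow_lt_pow_left₀ h1 h0 (by norm_num), pow_lt_pow_left₀ h2 hπ (by norm_num)⟩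

/-- **`𝔅(u_T) ∈ (57.00075175, 57.00075176)`** (eight decimals of the bed's value of record `57.000751751693…`;
`mainTermForm_taperProfile_window` has four). [cite: Zhang2022LandauSiegel, §7 (7.2) p.44] -/
theorem mainTermForm_taperProfile_window20 :
    57.00075175 < mainTermForm taperProfile taperProfile' ∧ mainTermForm taperProfile taperProfile' < 57.00075176 := by
  rw [mainTermForm_taperProfile]
  have hπ := Real.pi_gt_d20
  have hπ' := Real.pi_lt_d20
  have hπ0 : 0 < π := Real.pi_pos
  constructor
  · rw [div_add' _ _ _ hπ0.ne', lt_div_iff₀ hπ0]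
    nlinarith [mul_pos hπ0 (sub_pos.2 hπ')]
  · rw [div_add' _ _ _ hπ0.ne', div_lt_iff₀ hπ0]
    nlinarith [mul_pos hπ0 (sub_pos.2 hπ)]

/-- **Cell atoms at `(v_J, 2)`**: `k₀ = Re 𝔅_2(v_J) = 8/π + 52π/3`, `|c₀(u_T, v_2)|² = 36π²(1+π²)`.
[cite: Zhang2022LandauSiegel, §7 (7.2) p.44; §8 (8.11)–(8.12)] -/
theorem cellAtoms_jump_two :
    (topDiagForm 2 (jumpProfile 2) (jumpProfile' 2)).re = 8 / π + 52 / 3 * π ∧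
      ‖tailCoupling 2 taperProfile (jumpProfile 2)‖ ^ 2 = 36 * (π ^ 2 * (1 + π ^ 2)) := by
  rw [topDiagForm_jumpProfile_re (by norm_num : (1:ℝ) ≤ 2),
    norm_sq_tailCoupling_taper_jumpProfile (by norm_num : (1:ℝ) ≤ 2)]
  constructor <;> ring

/-- **Cell atoms at `(v_J, 3)`**: `k₀ = Re 𝔅_3(v_J) = 16/π + 416π/3`, `|c₀(u_T, v_3)|² = 576π²(1+π²)`.
[cite: Zhang2022LandauSiegel, §7 (7.2) p.44; §8 (8.11)–(8.12)] -/
theorem cellAtoms_jump_three :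
    (topDiagForm 3 (jumpProfile 3) (jumpProfile' 3)).re = 16 / π + 416 / 3 * π ∧
      ‖tailCoupling 3 taperProfile (jumpProfile 3)‖ ^ 2 = 576 * (π ^ 2 * (1 + π ^ 2)) := by
  rw [topDiagForm_jumpProfile_re (by norm_num : (1:ℝ) ≤ 3),
    norm_sq_tailCoupling_taper_jumpProfile (by norm_num : (1:ℝ) ≤ 3)]
  constructor <;> ring

/-- **Cell atoms at `(φ, 3)`**: `k₀ = Re 𝔅_3(φ_3) = 64/(3π) + 1408π/15`, `|c₀(u_T, φ_3)|² = 256π²(1+π²)`.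
[cite: Zhang2022LandauSiegel, §7 (7.2) p.44; §8 (8.11)–(8.12)] -/
theorem cellAtoms_phiT_three :
    (topDiagForm 3 (phiT 3) (phiT' 3)).re = 64 / (3 * π) + 1408 / 15 * π ∧
      ‖tailCoupling 3 taperProfile (phiT 3)‖ ^ 2 = 256 * (π ^ 2 * (1 + π ^ 2)) := by
  rw [topDiagForm_phiT_re (by norm_num : (1:ℝ) ≤ 3), norm_sq_tailCoupling_taper_phiT (by norm_num : (1:ℝ) ≤ 3)]
  constructor <;> ring

/-- **`b_m(v_J, 2) = 1`**: at `θ = 2` the jump's X = 0 overhang constant equals the taper's norm form,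
`Re 𝔅_2(v_J) = 8/π + 52π/3 = 𝔅(u_T)` (so at this cell the bed's shape numbers read `b_m = 1`, `|c_m|² = 1 − m_X0`).
[cite: Zhang2022LandauSiegel, §7 Prop 7.1 (7.2) p.44] -/
theorem topDiagForm_jump_two_re_eq_mainTermForm :
    (topDiagForm 2 (jumpProfile 2) (jumpProfile' 2)).re = mainTermForm taperProfile taperProfile' := by
  rw [cellAtoms_jump_two.1, mainTermForm_taperProfile]

/-- **`Re 𝔅_3(v_J) ∈ (440.7271394, 440.7271395)`** (`= 16/π + 416π/3`). [cite: Zhang2022LandauSiegel, §7 (7.2) p.44] -/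
theorem topDiagForm_jump_three_re_window :
    440.7271394 < (topDiagForm 3 (jumpProfile 3) (jumpProfile' 3)).re ∧
      (topDiagForm 3 (jumpProfile 3) (jumpProfile' 3)).re < 440.7271395 := by
  rw [cellAtoms_jump_three.1]
  have hπ := Real.pi_gt_d20
  have hπ' := Real.pi_lt_d20
  have hπ0 : 0 < π := Real.pi_pos
  constructor
  · rw [div_add' _ _ _ hπ0.ne', lt_div_iff₀ hπ0]
    nlinarith [mul_pos hπ0 (sub_pos.2 hπ')]
  · rw [div_add' _ _ _ hπ0.ne', div_lt_iff₀ hπ0]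
    nlinarith [mul_pos hπ0 (sub_pos.2 hπ)]

/-- **`Re 𝔅_3(φ_3) ∈ (301.6814413, 301.6814414)`** (`= 64/(3π) + 1408π/15`). [cite: Zhang2022LandauSiegel, §7 (7.2) p.44] -/
theorem topDiagForm_phiT_three_re_window :
    301.6814413 < (topDiagForm 3 (phiT 3) (phiT' 3)).re ∧ (topDiagForm 3 (phiT 3) (phiT' 3)).re < 301.6814414 := by
  rw [cellAtoms_phiT_three.1]
  have hπ := Real.pi_gt_d20
  have hπ' := Real.pi_lt_d20
  have hπ0 : 0 < π := Real.pi_pos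
  have h3 : 0 < 3 * π := by positivity
  constructor
  · rw [div_add' _ _ _ h3.ne', lt_div_iff₀ h3]
    nlinarith [mul_pos hπ0 (sub_pos.2 hπ')]
  · rw [div_add' _ _ _ h3.ne', div_lt_iff₀ h3]
    nlinarith [mul_pos hπ0 (sub_pos.2 hπ)]

/-- **`|c₀(u_T, v_2)|² ∈ (3862.0330, 3862.0331)`** (`= 36π²(1+π²)`). [cite: Zhang2022LandauSiegel, §8 (8.11)–(8.12)] -/
theorem normSq_tailCoupling_jump_two_window :
    3862.0330 < ‖tailCoupling 2 taperProfile (jumpProfile 2)‖ ^ 2 ∧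
      ‖tailCoupling 2 taperProfile (jumpProfile 2)‖ ^ 2 < 3862.0331 := by
  rw [cellAtoms_jump_two.2]
  obtain ⟨-, -, h2l, h2u, -, -, h4l, h4u⟩ := pi_bounds20
  norm_num at h2l h2u h4l h4u ⊢
  constructor <;> nlinarith [h2l, h2u, h4l, h4u]

/-- **`|c₀(u_T, v_3)|² ∈ (61792.5285, 61792.5286)`** (`= 576π²(1+π²)`). [cite: Zhang2022LandauSiegel, §8 (8.11)–(8.12)] -/
theorem normSq_tailCoupling_jump_three_window :
    61792.5285 < ‖tailCoupling 3 taperProfile (jumpProfile 3)‖ ^ 2 ∧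
      ‖tailCoupling 3 taperProfile (jumpProfile 3)‖ ^ 2 < 61792.5286 := by
  rw [cellAtoms_jump_three.2]
  obtain ⟨-, -, h2l, h2u, -, -, h4l, h4u⟩ := pi_bounds20
  norm_num at h2l h2u h4l h4u ⊢
  constructor <;> nlinarith [h2l, h2u, h4l, h4u]

/-- **`|c₀(u_T, φ_3)|² ∈ (27463.3460, 27463.3461)`** (`= 256π²(1+π²)`). [cite: Zhang2022LandauSiegel, §8 (8.11)–(8.12)] -/
theorem normSq_tailCoupling_phiT_three_window :
    27463.3460 < ‖tailCoupling 3 taperProfile (phiT 3)‖ ^ 2 ∧ ‖tailCoupling 3 taperProfile (phiT 3)‖ ^ 2 < 27463.3461 := by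
  rw [cellAtoms_phiT_three.2]
  obtain ⟨-, -, h2l, h2u, -, -, h4l, h4u⟩ := pi_bounds20
  norm_num at h2l h2u h4l h4u ⊢
  constructor <;> nlinarith [h2l, h2u, h4l, h4u]

end Atoms

/-! ### Part 1 — the kernel-mode restoration levels `m_K*(v,θ)` at the eight registered cells -/

section KernelModeLevels

/-- `m_K*(v_J,θ)` with `1/π` cleared: `144π²h⁴/(8h/π + 52πh³/3) = 432π³h³/(24 + 52π²h²)` (`h > 0`). [folklore] -/
private theorem mK_jump_alt {h : ℝ} (hh : 0 < h) :
    144 * π ^ 2 * h ^ 4 / (8 * h / π + 52 / 3 * π * h ^ 3) = 432 * π ^ 3 * h ^ 3 / (24 + 52 * π ^ 2 * h ^ 2) := by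
  have hπ : 0 < π := Real.pi_pos
  field_simp
  ring

/-- `m_K*(φ,θ)` with `1/π` cleared: `16π²h⁶/(8h³/(3π) + 44πh⁵/15) = 240π³h³/(40 + 44π²h²)` (`h > 0`). [folklore] -/
private theorem mK_arch_alt {h : ℝ} (hh : 0 < h) :
    16 * π ^ 2 * h ^ 6 / (8 * h ^ 3 / (3 * π) + 44 / 15 * π * h ^ 5)
      = 240 * π ^ 3 * h ^ 3 / (40 + 44 * π ^ 2 * h ^ 2) := by
  have hπ : 0 < π := Real.pi_pos
  field_simp
  ring

/-- **The jump level at `θ`**: `uKThreshold (M_θ(g⋆, v_J)) (Re 𝔅_θ(v_J)) = 432π³h³/(24 + 52π²h²)`, `h = θ − 1 > 0`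
(`MformTop_gStar_jumpProfile` + `uKThreshold_jump_closed`). [cite: Zhang2022LandauSiegel, §7 (7.2) p.44; §8 (8.11)–(8.12)] -/
theorem uKThreshold_gStar_jump_eq {θ : ℝ} (hθ : 1 < θ) :
    uKThreshold (MformTop θ gStar gStar' (jumpProfile θ) (jumpProfile' θ))
        (topDiagForm θ (jumpProfile θ) (jumpProfile' θ)).re
      = 432 * π ^ 3 * (θ - 1) ^ 3 / (24 + 52 * π ^ 2 * (θ - 1) ^ 2) := by
  rw [(MformTop_gStar_jumpProfile hθ.le).1, uKThreshold_jump_closed hθ.le, mK_jump_alt (by linarith)]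

/-- **The arch level at `θ`**: `uKThreshold (M_θ(g⋆, φ_θ)) (Re 𝔅_θ(φ_θ)) = 240π³h³/(40 + 44π²h²)`, `h = θ − 1 > 0`
(`MformTop_gStar_phiT_eq` + `uKThreshold_arch_closed`). [cite: Zhang2022LandauSiegel, §7 (7.2) p.44; §8 (8.11)–(8.12)] -/
theorem uKThreshold_gStar_phiT_eq {θ : ℝ} (hθ : 1 < θ) :
    uKThreshold (MformTop θ gStar gStar' (phiT θ) (phiT' θ)) (topDiagForm θ (phiT θ) (phiT' θ)).re
      = 240 * π ^ 3 * (θ - 1) ^ 3 / (40 + 44 * π ^ 2 * (θ - 1) ^ 2) := by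
  rw [MformTop_gStar_phiT_eq hθ.le, uKThreshold_arch_closed hθ.le, mK_arch_alt (by linarith)]

/-- A quotient window from polynomial inequalities: `lo·D < N < hi·D`, `D > 0` ⇒ `lo < N/D < hi`. [folklore] -/
private theorem div_window {N D lo hi : ℝ} (hD : 0 < D) (h1 : lo * D < N) (h2 : N < hi * D) :
    lo < N / D ∧ N / D < hi :=
  ⟨(lt_div_iff₀ hD).2 h1, (div_lt_iff₀ hD).2 h2⟩

/-- **`m_K*(v_J, 5/4) ∈ (3.73, 3.74)`** (bed-7 printed `3.73`). [cite: Zhang2022LandauSiegel, §7 (7.2) p.44] -/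
theorem uKThreshold_window_jump_five_quarters :
    3.73 < uKThreshold (MformTop (5/4) gStar gStar' (jumpProfile (5/4)) (jumpProfile' (5/4)))
        (topDiagForm (5/4) (jumpProfile (5/4)) (jumpProfile' (5/4))).re ∧
      uKThreshold (MformTop (5/4) gStar gStar' (jumpProfile (5/4)) (jumpProfile' (5/4)))
        (topDiagForm (5/4) (jumpProfile (5/4)) (jumpProfile' (5/4))).re < 3.74 := by
  rw [uKThreshold_gStar_jump_eq (by norm_num)]
  obtain ⟨-, -, h2l, h2u, h3l, h3u, -, -⟩ := pi_bounds20
  norm_num at h2l h2u h3l h3u ⊢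
  exact div_window (by positivity) (by nlinarith [h2l, h2u, h3l, h3u]) (by nlinarith [h2l, h2u, h3l, h3u])

/-- **`m_K*(v_J, 3/2) ∈ (10.99, 11.00)`** (bed-7 printed `10.99`). [cite: Zhang2022LandauSiegel, §7 (7.2) p.44] -/
theorem uKThreshold_window_jump_three_halves :
    10.99 < uKThreshold (MformTop (3/2) gStar gStar' (jumpProfile (3/2)) (jumpProfile' (3/2)))
        (topDiagForm (3/2) (jumpProfile (3/2)) (jumpProfile' (3/2))).re ∧
      uKThreshold (MformTop (3/2) gStar gStar' (jumpProfile (3/2)) (jumpProfile' (3/2)))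
        (topDiagForm (3/2) (jumpProfile (3/2)) (jumpProfile' (3/2))).re < 11 := by
  rw [uKThreshold_gStar_jump_eq (by norm_num)]
  obtain ⟨-, -, h2l, h2u, h3l, h3u, -, -⟩ := pi_bounds20
  norm_num at h2l h2u h3l h3u ⊢
  exact div_window (by positivity) (by nlinarith [h2l, h2u, h3l, h3u]) (by nlinarith [h2l, h2u, h3l, h3u])

/-- **`m_K*(v_J, 2) ∈ (24.93, 24.94)`** (bed-7 printed `24.93`). [cite: Zhang2022LandauSiegel, §7 (7.2) p.44] -/
theorem uKThreshold_window_jump_two :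
    24.93 < uKThreshold (MformTop 2 gStar gStar' (jumpProfile 2) (jumpProfile' 2))
        (topDiagForm 2 (jumpProfile 2) (jumpProfile' 2)).re ∧
      uKThreshold (MformTop 2 gStar gStar' (jumpProfile 2) (jumpProfile' 2))
        (topDiagForm 2 (jumpProfile 2) (jumpProfile' 2)).re < 24.94 := by
  rw [uKThreshold_gStar_jump_eq (by norm_num)]
  obtain ⟨-, -, h2l, h2u, h3l, h3u, -, -⟩ := pi_bounds20
  norm_num at h2l h2u h3l h3u ⊢
  exact div_window (by positivity) (by nlinarith [h2l, h2u, h3l, h3u]) (by nlinarith [h2l, h2u, h3l, h3u])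

/-- **`m_K*(v_J, 3) ∈ (51.59, 51.60)`** (bed-7 printed `51.60`). [cite: Zhang2022LandauSiegel, §7 (7.2) p.44] -/
theorem uKThreshold_window_jump_three :
    51.59 < uKThreshold (MformTop 3 gStar gStar' (jumpProfile 3) (jumpProfile' 3))
        (topDiagForm 3 (jumpProfile 3) (jumpProfile' 3)).re ∧
      uKThreshold (MformTop 3 gStar gStar' (jumpProfile 3) (jumpProfile' 3))
        (topDiagForm 3 (jumpProfile 3) (jumpProfile' 3)).re < 51.6 := by
  rw [uKThreshold_gStar_jump_eq (by norm_num)]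
  obtain ⟨-, -, h2l, h2u, h3l, h3u, -, -⟩ := pi_bounds20
  norm_num at h2l h2u h3l h3u ⊢
  exact div_window (by positivity) (by nlinarith [h2l, h2u, h3l, h3u]) (by nlinarith [h2l, h2u, h3l, h3u])

/-- **`m_K*(φ, 5/4) ∈ (1.73, 1.74)`** (bed-7 printed `1.73`). [cite: Zhang2022LandauSiegel, §7 (7.2) p.44] -/
theorem uKThreshold_window_phiT_five_quarters :
    1.73 < uKThreshold (MformTop (5/4) gStar gStar' (phiT (5/4)) (phiT' (5/4)))
        (topDiagForm (5/4) (phiT (5/4)) (phiT' (5/4))).re ∧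
      uKThreshold (MformTop (5/4) gStar gStar' (phiT (5/4)) (phiT' (5/4)))
        (topDiagForm (5/4) (phiT (5/4)) (phiT' (5/4))).re < 1.74 := by
  rw [uKThreshold_gStar_phiT_eq (by norm_num)]
  obtain ⟨-, -, h2l, h2u, h3l, h3u, -, -⟩ := pi_bounds20
  norm_num at h2l h2u h3l h3u ⊢
  exact div_window (by positivity) (by nlinarith [h2l, h2u, h3l, h3u]) (by nlinarith [h2l, h2u, h3l, h3u])

/-- **`m_K*(φ, 3/2) ∈ (6.26, 6.27)`** (bed-7 printed `6.26`). [cite: Zhang2022LandauSiegel, §7 (7.2) p.44] -/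
theorem uKThreshold_window_phiT_three_halves :
    6.26 < uKThreshold (MformTop (3/2) gStar gStar' (phiT (3/2)) (phiT' (3/2)))
        (topDiagForm (3/2) (phiT (3/2)) (phiT' (3/2))).re ∧
      uKThreshold (MformTop (3/2) gStar gStar' (phiT (3/2)) (phiT' (3/2)))
        (topDiagForm (3/2) (phiT (3/2)) (phiT' (3/2))).re < 6.27 := by
  rw [uKThreshold_gStar_phiT_eq (by norm_num)]
  obtain ⟨-, -, h2l, h2u, h3l, h3u, -, -⟩ := pi_bounds20
  norm_num at h2l h2u h3l h3u ⊢
  exact div_window (by positivity) (by nlinarith [h2l, h2u, h3l, h3u]) (by nlinarith [h2l, h2u, h3l, h3u])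

/-- **`m_K*(φ, 2) ∈ (15.69, 15.70)`** (bed-7 printed `15.69`). [cite: Zhang2022LandauSiegel, §7 (7.2) p.44] -/
theorem uKThreshold_window_phiT_two :
    15.69 < uKThreshold (MformTop 2 gStar gStar' (phiT 2) (phiT' 2)) (topDiagForm 2 (phiT 2) (phiT' 2)).re ∧
      uKThreshold (MformTop 2 gStar gStar' (phiT 2) (phiT' 2)) (topDiagForm 2 (phiT 2) (phiT' 2)).re < 15.7 := by
  rw [uKThreshold_gStar_phiT_eq (by norm_num)]
  obtain ⟨-, -, h2l, h2u, h3l, h3u, -, -⟩ := pi_bounds20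
  norm_num at h2l h2u h3l h3u ⊢
  exact div_window (by positivity) (by nlinarith [h2l, h2u, h3l, h3u]) (by nlinarith [h2l, h2u, h3l, h3u])

/-- **`m_K*(φ, 3) ∈ (33.50, 33.51)`** (bed-7 printed `33.50`). [cite: Zhang2022LandauSiegel, §7 (7.2) p.44] -/
theorem uKThreshold_window_phiT_three :
    33.5 < uKThreshold (MformTop 3 gStar gStar' (phiT 3) (phiT' 3)) (topDiagForm 3 (phiT 3) (phiT' 3)).re ∧
      uKThreshold (MformTop 3 gStar gStar' (phiT 3) (phiT' 3)) (topDiagForm 3 (phiT 3) (phiT' 3)).re < 33.51 := by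
  rw [uKThreshold_gStar_phiT_eq (by norm_num)]
  obtain ⟨-, -, h2l, h2u, h3l, h3u, -, -⟩ := pi_bounds20
  norm_num at h2l h2u h3l h3u ⊢
  exact div_window (by positivity) (by nlinarith [h2l, h2u, h3l, h3u]) (by nlinarith [h2l, h2u, h3l, h3u])

end KernelModeLevels

end Literature.NumberTheory.LFunctions.Zhang2022.Repair.Bed
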